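import Summits.CriticalPhenomena.PercolationContinuityZ3.Theorems.PercNearOneGluingNoHeavyLowerTailThreePointProductFormFibreTreeConversions
import HarnessLib

/-!
# (P) on tree-like fibres, II: the assembly (Sahi programme, prover prim-sahi-p2 gen 59)

Support file (`--supports stmt-CriticalPhenomena-4575`, helper).  Standard axioms, no sorries, no named facts, no definitions.
Memo `run/shared/lean/prim/prim-sahi/FROM-prim-sahi-p2-gen59-ONE-STEP-LEMMA.md` §2, §8(2); `prim-sahi-p2/PROOF-E3.md` (68j), §69.

A TREE STRUCTURE on the labels: trunk vertices `T`, children `ch v` (height `ht` decreasing), the label `e u : v — u` to each child, mark labels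
`Ms v : v — s`, `Mc v : v — c`, the sub-instance mask `mQ v = ⋃_{u ∈ ch v} ({e u} ∪ mQ u) ∪ Ms v ∪ Mc v`, and private vertex classes `Sv u`
(containing `u`, containing a private endpoint of every `mQ u`-label, all of whose endpoints lie in `Sv u ∪ {s,c}`, terminal-free, not containing
the parent, pairwise disjoint among siblings).  This file: the piece family at a trunk vertex satisfies the hypotheses of the n-ary parallel
composition law (`family_hyps`), its product splits into children and marks (`prod_family`), and the generic normalisation algebra (`assemble_eq`).
[this work] (gen 59).
-/

namespace Summit.CriticalPhenomena.PercolationContinuityZ3.Theorems.ProductFormFibre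

open Finset Literature.Probability.Percolation
open Summit.CriticalPhenomena.PercolationContinuityZ3.Theorems.ThreePointCPIClusterSwap (clusterFlip)

variable {V α : Type*}

/-! ### 1. Algebra of the normalisation -/

/-- The normalisation algebra: from `N · U^{m+ks+kc} = U · (X / 2^m) · ((U/2)·φS)^{ks} · ((U/2)·φC)^{kc}` to
`N = κ · (φS^{ks} · φC^{kc} · X)` with `κ = U^{1+ks+kc} / (U^{m+ks+kc} · 2^{m+ks+kc})`. [this work] -/
theorem assemble_eq (N U X φS φC : ℝ) (m ks kc : ℕ) (hU : 0 < U)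
    (hfam : N * U ^ (m + ks + kc) = U * (X / 2 ^ m) * ((U / 2) * φS) ^ ks * ((U / 2) * φC) ^ kc) :
    N = (U ^ (1 + ks + kc) / (U ^ (m + ks + kc) * 2 ^ (m + ks + kc))) * (φS ^ ks * φC ^ kc * X) := by
  have hUn : U ^ (m + ks + kc) ≠ 0 := pow_ne_zero _ hU.ne'
  have hN : N = U * (X / 2 ^ m) * ((U / 2) * φS) ^ ks * ((U / 2) * φC) ^ kc / U ^ (m + ks + kc) := by
    rw [← hfam, mul_div_assoc, div_self hUn, mul_one]
  rw [hN, mul_pow, mul_pow, div_pow, div_pow]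
  have hU' : U ≠ 0 := hU.ne'
  have h2 : (2 : ℝ) ^ m ≠ 0 := pow_ne_zero _ two_ne_zero
  have h2' : (2 : ℝ) ^ ks ≠ 0 := pow_ne_zero _ two_ne_zero
  have h2'' : (2 : ℝ) ^ kc ≠ 0 := pow_ne_zero _ two_ne_zero
  field_simp
  ring

/-! ### 2. The family of pieces at a trunk vertex -/

section Family

variable [Fintype α] [DecidableEq α] [DecidableEq V] (ends : α → Sym2 V) (s c : V)
  (T : V → Prop) (ch : V → Finset V) (mQ : V → α → Bool) (Sv : V → V → Prop) (e : V → α) (Ms Mc : V → Finset α)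

omit [Fintype α] in
/-- **The pieces at a trunk vertex satisfy the hypotheses of the n-ary parallel composition law** (family indexed by `V ⊕ α`:
children `inl u` with mask `{e u} ∪ mQ u` and vertex class `Sv u`, marks `inr m` with mask `{m}` and empty vertex class). [this work] -/
theorem family_hyps (hT : ∀ v, T v → v ≠ s ∧ v ≠ c)
    (hch : ∀ v, T v → ∀ u ∈ ch v, T u)
    (he : ∀ v, T v → ∀ u ∈ ch v, ends (e u) = s(v, u))
    (hMs : ∀ v, T v → ∀ m ∈ Ms v, ends m = s(v, s)) (hMc : ∀ v, T v → ∀ m ∈ Mc v, ends m = s(v, c))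
    (hSv1 : ∀ u, T u → Sv u u)
    (hSv2 : ∀ u, T u → ∀ l, mQ u l = true → (∀ x ∈ ends l, Sv u x ∨ (x = s ∨ x = c)) ∧ (∃ x ∈ ends l, Sv u x))
    (hSv3 : ∀ u, T u → ∀ x, Sv u x → x ≠ s ∧ x ≠ c)
    (hSv4 : ∀ v, T v → ∀ u ∈ ch v, ∀ x, Sv u x → x ≠ v)
    (hSv5 : ∀ v, T v → ∀ u ∈ ch v, ∀ u' ∈ ch v, u ≠ u' → ∀ x, Sv u x → ¬ Sv u' x)
    (w : V) (hw : T w) :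
    let J : Finset (V ⊕ α) := (ch w).map ⟨Sum.inl, Sum.inl_injective⟩ ∪ (Ms w ∪ Mc w).map ⟨Sum.inr, Sum.inr_injective⟩
    let mp : V ⊕ α → α → Bool := fun j => Sum.elim (fun u => fun y => decide (y = e u) || mQ u y) (fun m => fun y => decide (y = m)) j
    let Pp : V ⊕ α → V → Prop := fun j => Sum.elim (fun u => Sv u) (fun _ => fun _ => False) j
    (∀ j ∈ J, ∀ l, mp j l = true → ∀ x ∈ ends l, Pp j x ∨ (x = s ∨ x = w ∨ x = c)) ∧
    (∀ j ∈ J, ∀ x, Pp j x → ¬ (x = s ∨ x = w ∨ x = c)) ∧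
    (∀ j ∈ J, ∀ j' ∈ J, j ≠ j' → ∀ x, Pp j x → ¬ Pp j' x) ∧
    (∀ j ∈ J, ∀ j' ∈ J, j ≠ j' → ∀ l, mp j l = true → ¬ mp j' l = true) := by
  intro J mp Pp
  -- membership in J
  have hJ : ∀ j ∈ J, (∃ u ∈ ch w, j = Sum.inl u) ∨ (∃ m ∈ Ms w ∪ Mc w, j = Sum.inr m) := by
    intro j hj
    rcases Finset.mem_union.mp hj with hj | hj
    · simp only [Finset.mem_map, Function.Embedding.coeFn_mk] at hj
      obtain ⟨u, hu, rfl⟩ := hj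
      exact Or.inl ⟨u, hu, rfl⟩
    · simp only [Finset.mem_map, Function.Embedding.coeFn_mk] at hj
      obtain ⟨m, hm, rfl⟩ := hj
      exact Or.inr ⟨m, hm, rfl⟩
  have hmark : ∀ m ∈ Ms w ∪ Mc w, ends m = s(w, s) ∨ ends m = s(w, c) := by
    intro m hm
    rcases Finset.mem_union.mp hm with h | h
    · exact Or.inl (hMs w hw m h)
    · exact Or.inr (hMc w hw m h)
  obtain ⟨hws, hwc⟩ := hT w hw
  -- a child's piece label has endpoints in `Sv u ∪ {s, w, c}` and is not a mark, etc.
  have child_lab : ∀ u ∈ ch w, ∀ l, (decide (l = e u) || mQ u l) = true →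
      ∀ x ∈ ends l, Sv u x ∨ (x = s ∨ x = w ∨ x = c) := by
    intro u hu l hl x hx
    simp only [Bool.or_eq_true, decide_eq_true_eq] at hl
    rcases hl with rfl | hl
    · rw [he w hw u hu] at hx
      rcases Sym2.mem_iff.mp hx with hx1 | hx1
      · exact Or.inr (Or.inr (Or.inl hx1))
      · rw [hx1]; exact Or.inl (hSv1 u (hch w hw u hu))
    · rcases (hSv2 u (hch w hw u hu) l hl).1 x hx with h | h | h
      · exact Or.inl h
      · exact Or.inr (Or.inl h)
      · exact Or.inr (Or.inr (Or.inr h))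
  refine ⟨?_, ?_, ?_, ?_⟩
  · intro j hj l hl x hx
    rcases hJ j hj with ⟨u, hu, rfl⟩ | ⟨m, hm, rfl⟩
    · exact child_lab u hu l hl x hx
    · simp only [mp, Sum.elim_inr, decide_eq_true_eq] at hl
      subst hl
      right
      rcases hmark l hm with h | h <;> rw [h] at hx <;> rcases Sym2.mem_iff.mp hx with hx1 | hx1
      · exact Or.inr (Or.inl hx1)
      · exact Or.inl hx1
      · exact Or.inr (Or.inl hx1)
      · exact Or.inr (Or.inr hx1)
  · intro j hj x hx
    rcases hJ j hj with ⟨u, hu, rfl⟩ | ⟨m, hm, rfl⟩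
    · simp only [Pp, Sum.elim_inl] at hx
      obtain ⟨h1, h2⟩ := hSv3 u (hch w hw u hu) x hx
      have h3 := hSv4 w hw u hu x hx
      rintro (h | h | h)
      · exact h1 h
      · exact h3 h
      · exact h2 h
    · simp only [Pp, Sum.elim_inr] at hx
  · intro j hj j' hj' hne x hx hx'
    rcases hJ j hj with ⟨u, hu, rfl⟩ | ⟨m, hm, rfl⟩
    · rcases hJ j' hj' with ⟨u', hu', rfl⟩ | ⟨m', hm', rfl⟩
      · simp only [Pp, Sum.elim_inl] at hx hx'
        exact hSv5 w hw u hu u' hu' (fun h => hne (by rw [h])) x hx hx'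
      · simp only [Pp, Sum.elim_inr] at hx'
    · simp only [Pp, Sum.elim_inr] at hx
  · intro j hj j' hj' hne l hl hl'
    rcases hJ j hj with ⟨u, hu, rfl⟩ | ⟨m, hm, rfl⟩
    · rcases hJ j' hj' with ⟨u', hu', rfl⟩ | ⟨m', hm', rfl⟩
      · -- two children
        have huu : u ≠ u' := fun h => hne (by rw [h])
        simp only [mp, Sum.elim_inl, Bool.or_eq_true, decide_eq_true_eq] at hl hl'
        have hTu := hch w hw u hu; have hTu' := hch w hw u' hu'
        rcases hl with rfl | hl <;> rcases hl' with h' | hl'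
        · -- e u = e u'
          have := he w hw u hu; rw [h', he w hw u' hu'] at this
          have hmem : u' ∈ s(w, u) := by rw [← this]; exact Sym2.mem_mk_right w u'
          rcases Sym2.mem_iff.mp hmem with h | h
          · exact hSv4 w hw u' hu' u' (hSv1 u' hTu') h
          · exact huu h.symm
        · -- e u ∈ mQ u'
          obtain ⟨x, hx, hSx⟩ := (hSv2 u' hTu' _ hl').2
          rw [he w hw u hu] at hx
          rcases Sym2.mem_iff.mp hx with hx1 | hx1
          · exact hSv4 w hw u' hu' x hSx hx1
          · rw [hx1] at hSx; exact hSv5 w hw u hu u' hu' huu u (hSv1 u hTu) hSx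
        · -- e u' ∈ mQ u
          rw [h'] at hl
          obtain ⟨x, hx, hSx⟩ := (hSv2 u hTu _ hl).2
          rw [he w hw u' hu'] at hx
          rcases Sym2.mem_iff.mp hx with hx1 | hx1
          · exact hSv4 w hw u hu x hSx hx1
          · rw [hx1] at hSx; exact hSv5 w hw u' hu' u hu (Ne.symm huu) u' (hSv1 u' hTu') hSx
        · -- common label of mQ u and mQ u'
          obtain ⟨x, hx, hSx⟩ := (hSv2 u hTu l hl).2
          rcases (hSv2 u' hTu' l hl').1 x hx with h | h | h
          · exact hSv5 w hw u hu u' hu' huu x hSx h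
          · exact (hSv3 u hTu x hSx).1 h
          · exact (hSv3 u hTu x hSx).2 h
      · -- child and mark
        simp only [mp, Sum.elim_inl, Sum.elim_inr, Bool.or_eq_true, decide_eq_true_eq] at hl hl'
        subst hl'
        have hTu := hch w hw u hu
        rcases hl with h | hl
        · -- the mark equals e u
          have h1 := he w hw u hu; rw [← h] at h1
          rcases hmark l hm' with h2 | h2 <;> rw [h1] at h2
          · have : u ∈ s(w, s) := by rw [← h2]; exact Sym2.mem_mk_right w u
            rcases Sym2.mem_iff.mp this with h3 | h3
            · exact hSv4 w hw u hu u (hSv1 u hTu) h3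
            · exact (hT u hTu).1 h3
          · have : u ∈ s(w, c) := by rw [← h2]; exact Sym2.mem_mk_right w u
            rcases Sym2.mem_iff.mp this with h3 | h3
            · exact hSv4 w hw u hu u (hSv1 u hTu) h3
            · exact (hT u hTu).2 h3
        · obtain ⟨x, hx, hSx⟩ := (hSv2 u hTu l hl).2
          rcases hmark l hm' with h2 | h2 <;> rw [h2] at hx <;> rcases Sym2.mem_iff.mp hx with hx1 | hx1
          · exact hSv4 w hw u hu x hSx hx1
          · exact (hSv3 u hTu x hSx).1 hx1
          · exact hSv4 w hw u hu x hSx hx1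
          · exact (hSv3 u hTu x hSx).2 hx1
    · rcases hJ j' hj' with ⟨u', hu', rfl⟩ | ⟨m', hm', rfl⟩
      · -- mark and child (symmetric)
        simp only [mp, Sum.elim_inl, Sum.elim_inr, Bool.or_eq_true, decide_eq_true_eq] at hl hl'
        subst hl
        have hTu := hch w hw u' hu'
        rcases hl' with h | hl'
        · have h1 := he w hw u' hu'; rw [← h] at h1
          rcases hmark l hm with h2 | h2 <;> rw [h1] at h2
          · have : u' ∈ s(w, s) := by rw [← h2]; exact Sym2.mem_mk_right w u'
            rcases Sym2.mem_iff.mp this with h3 | h3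
            · exact hSv4 w hw u' hu' u' (hSv1 u' hTu) h3
            · exact (hT u' hTu).1 h3
          · have : u' ∈ s(w, c) := by rw [← h2]; exact Sym2.mem_mk_right w u'
            rcases Sym2.mem_iff.mp this with h3 | h3
            · exact hSv4 w hw u' hu' u' (hSv1 u' hTu) h3
            · exact (hT u' hTu).2 h3
        · obtain ⟨x, hx, hSx⟩ := (hSv2 u' hTu l hl').2
          rcases hmark l hm with h2 | h2 <;> rw [h2] at hx <;> rcases Sym2.mem_iff.mp hx with hx1 | hx1
          · exact hSv4 w hw u' hu' x hSx hx1
          · exact (hSv3 u' hTu x hSx).1 hx1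
          · exact hSv4 w hw u' hu' x hSx hx1
          · exact (hSv3 u' hTu x hSx).2 hx1
      · -- two marks: same label
        simp only [mp, Sum.elim_inr, decide_eq_true_eq] at hl hl'
        exact hne (by rw [← hl, ← hl'])

omit [Fintype α] in
/-- The product over the family splits into children and marks; its size. [this work] -/
theorem prod_family (w : V) (F : (α → Bool) → ℝ)
    (hMM : Disjoint (Ms w) (Mc w)) :
    let J : Finset (V ⊕ α) := (ch w).map ⟨Sum.inl, Sum.inl_injective⟩ ∪ (Ms w ∪ Mc w).map ⟨Sum.inr, Sum.inr_injective⟩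
    let mp : V ⊕ α → α → Bool := fun j => Sum.elim (fun u => fun y => decide (y = e u) || mQ u y) (fun m => fun y => decide (y = m)) j
    (∏ j ∈ J, F (mp j)) = (∏ u ∈ ch w, F (fun y => decide (y = e u) || mQ u y)) *
      ((∏ m ∈ Ms w, F (fun y => decide (y = m))) * ∏ m ∈ Mc w, F (fun y => decide (y = m))) ∧
    J.card = (ch w).card + ((Ms w).card + (Mc w).card) := by
  intro J mp
  have hdisj : Disjoint ((ch w).map ⟨Sum.inl, Sum.inl_injective⟩) ((Ms w ∪ Mc w).map ⟨Sum.inr, Sum.inr_injective⟩) := by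
    rw [Finset.disjoint_left]
    intro j hj hj'
    simp only [Finset.mem_map, Function.Embedding.coeFn_mk] at hj hj'
    obtain ⟨u, -, rfl⟩ := hj
    obtain ⟨m, -, h⟩ := hj'
    exact Sum.inr_ne_inl h
  constructor
  · rw [Finset.prod_union hdisj, Finset.prod_map, Finset.prod_map, Finset.prod_union hMM]
    simp only [mp, Function.Embedding.coeFn_mk, Sum.elim_inl, Sum.elim_inr]
  · rw [Finset.card_union_of_disjoint hdisj, Finset.card_map, Finset.card_map, Finset.card_union_of_disjoint hMM]


omit [Fintype α] in
/-- The union mask of the family at `w` is the sub-instance mask `mQ w`. [this work] -/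
theorem unionMask_eq
    (hmQ : ∀ v, T v → ∀ l, (mQ v l = true ↔ (∃ u ∈ ch v, l = e u ∨ mQ u l = true) ∨ l ∈ Ms v ∨ l ∈ Mc v))
    (w : V) (hw : T w) (y : α) :
    decide (∃ j ∈ (ch w).map ⟨Sum.inl, Sum.inl_injective⟩ ∪ (Ms w ∪ Mc w).map ⟨Sum.inr, Sum.inr_injective⟩,
      (fun j => Sum.elim (fun u => fun y => decide (y = e u) || mQ u y) (fun m => fun y => decide (y = m)) j) j y = true) =
    mQ w y := by
  have key : (∃ j ∈ (ch w).map ⟨Sum.inl, Sum.inl_injective⟩ ∪ (Ms w ∪ Mc w).map ⟨Sum.inr, Sum.inr_injective⟩,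
      (fun j => Sum.elim (fun u => fun y => decide (y = e u) || mQ u y) (fun m => fun y => decide (y = m)) j) j y = true) ↔
      mQ w y = true := by
    rw [hmQ w hw y]
    constructor
    · rintro ⟨j, hj, hjy⟩
      rcases Finset.mem_union.mp hj with hj | hj
      · simp only [Finset.mem_map, Function.Embedding.coeFn_mk] at hj
        obtain ⟨u, hu, rfl⟩ := hj
        simp only [Sum.elim_inl, Bool.or_eq_true, decide_eq_true_eq] at hjy
        exact Or.inl ⟨u, hu, hjy⟩
      · simp only [Finset.mem_map, Function.Embedding.coeFn_mk] at hj
        obtain ⟨m, hm, rfl⟩ := hj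
        simp only [Sum.elim_inr, decide_eq_true_eq] at hjy
        subst hjy
        rcases Finset.mem_union.mp hm with h | h
        · exact Or.inr (Or.inl h)
        · exact Or.inr (Or.inr h)
    · rintro (⟨u, hu, h⟩ | h | h)
      · refine ⟨Sum.inl u, Finset.mem_union.mpr (Or.inl ?_), ?_⟩
        · simp only [Finset.mem_map, Function.Embedding.coeFn_mk]; exact ⟨u, hu, rfl⟩
        · simp only [Sum.elim_inl, Bool.or_eq_true, decide_eq_true_eq]; exact h
      · refine ⟨Sum.inr y, Finset.mem_union.mpr (Or.inr ?_), ?_⟩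
        · simp only [Finset.mem_map, Function.Embedding.coeFn_mk]; exact ⟨y, Finset.mem_union.mpr (Or.inl h), rfl⟩
        · simp only [Sum.elim_inr, decide_eq_true_eq]
      · refine ⟨Sum.inr y, Finset.mem_union.mpr (Or.inr ?_), ?_⟩
        · simp only [Finset.mem_map, Function.Embedding.coeFn_mk]; exact ⟨y, Finset.mem_union.mpr (Or.inr h), rfl⟩
        · simp only [Sum.elim_inr, decide_eq_true_eq]
  by_cases h : mQ w y = true
  · rw [h]; exact decide_eq_true (key.2 h)
  · have h' : mQ w y = false := by simpa using h
    rw [h']; exact decide_eq_false (fun hh => h (key.1 hh))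

omit [Fintype α] [DecidableEq α] [DecidableEq V] in
/-- The `s`-marks and the `c`-marks at a trunk vertex are disjoint. [this work] -/
theorem marks_disjoint (hsc : s ≠ c) (hT : ∀ v, T v → v ≠ s ∧ v ≠ c)
    (hMs : ∀ v, T v → ∀ m ∈ Ms v, ends m = s(v, s)) (hMc : ∀ v, T v → ∀ m ∈ Mc v, ends m = s(v, c))
    (w : V) (hw : T w) : Disjoint (Ms w) (Mc w) := by
  rw [Finset.disjoint_left]; intro m h1 h2
  have := hMs w hw m h1; rw [hMc w hw m h2] at this
  have hmem : c ∈ s(w, s) := by rw [← this]; exact Sym2.mem_mk_right w c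
  rcases Sym2.mem_iff.mp hmem with h | h
  · exact (hT w hw).2 h.symm
  · exact hsc h.symm

omit [Fintype α] [DecidableEq α] [DecidableEq V] in
/-- The hypotheses of the series-piece theorems at a child of a trunk vertex. [this work] -/
theorem child_hyps (hT : ∀ v, T v → v ≠ s ∧ v ≠ c) (hch : ∀ v, T v → ∀ u ∈ ch v, T u)
    (he : ∀ v, T v → ∀ u ∈ ch v, ends (e u) = s(v, u))
    (hSv1 : ∀ u, T u → Sv u u)
    (hSv2 : ∀ u, T u → ∀ l, mQ u l = true → (∀ x ∈ ends l, Sv u x ∨ (x = s ∨ x = c)) ∧ (∃ x ∈ ends l, Sv u x))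
    (hSv4 : ∀ v, T v → ∀ u ∈ ch v, ∀ x, Sv u x → x ≠ v)
    (w : V) (hw : T w) (u : V) (hu : u ∈ ch w) :
    u ≠ w ∧ (∀ l, mQ u l = true → ∀ v ∈ ends l, v ≠ w) ∧ mQ u (e u) = false := by
  obtain ⟨hws, hwc⟩ := hT w hw
  have hTu := hch w hw u hu
  refine ⟨fun h => hSv4 w hw u hu u (hSv1 u hTu) h, ?_, ?_⟩
  · intro l hl v hv hvw
    rcases (hSv2 u hTu l hl).1 v hv with h | h | h
    · exact hSv4 w hw u hu v h hvw
    · exact hws (hvw ▸ h)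
    · exact hwc (hvw ▸ h)
  · by_contra hc
    have hc' : mQ u (e u) = true := by simpa using hc
    have hwmem : w ∈ ends (e u) := by rw [he w hw u hu]; exact Sym2.mem_mk_left w u
    rcases (hSv2 u hTu _ hc').1 w hwmem with h | h | h
    · exact hSv4 w hw u hu w h rfl
    · exact hws h
    · exact hwc h

end Family

end Summit.CriticalPhenomena.PercolationContinuityZ3.Theorems.ProductFormFibre
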